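import Summits.ResolutionOfSingularities.ResolutionOfSingularities.Theorems.HomologicalConductorNoZenoRLipman131Rational
import Literature.AlgebraicGeometry.Resolution.Lipman1969ConverseBaseChangeOfB
import Literature.AlgebraicGeometry.Resolution.ExcDivisorDegreeH0
import HarnessLib

/-!
# Crux `NoZenoR` (stmt-ResolutionOfSingularities-19943) — further consequences of `Lipman1969_1_2_B_holds`:
# Lipman 1969 Prop. (16.5) (formally smooth base change of rational surface singularities) is a THEOREM, and
# Prop. (13.1) d) for effective exceptional divisors is unconditional

Route `ResolutionOfSingularities/HomologicalConductor` (cell decomp-res, hand leafhand-res-homologicalconduct-18 g0).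
OURS: AI-written bookkeeping over tree theorems, weaker than expert review; nothing here is a statement of the manuscript
under review (Hironaka 2017).  SUPPORT level, counted 0.  Def-free, no new named facts.

* `Lipman1969_16_5_holds : Lipman1969_16_5.{u}` — the named fact
  `Literature.AlgebraicGeometry.Resolution.Lipman1969_16_5` (Lipman 1969, Prop. (16.5): for a flat local homomorphism
  `A → B` of two-dimensional Noetherian local rings with `𝔪_A B = 𝔪_B` and separable residue extension, and `A` admitting
  a desingularization, `A` is normal iff `B` is, and then `A` has a rational singularity iff `B` does) DISCHARGED at every
  universe: the tree's `Lipman1969_16_5_of_B` (typer of `Lipman1969ConverseBaseChangeOfB`) fed with `Lipman1969_1_2_B_holds`.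
* `Lipman1969_16_5_rational_iff` — its rationality clause, unconditional.
* `excCurveDegree_prod_eq_h0_of_hasRationalSingularity` — `(D·E_η) = h⁰(𝓘_η) + h⁰(𝓛_t) − h⁰(𝓛_t𝓘_η)` for every
  effective exceptional divisor on any desingularization of a rational surface singularity (hand 16 g0's
  `excCurveDegree_prod_eq_h0_of_1_2` with Prop. (1.2) discharged).

No crux or summit statement is proved here.
-/

noncomputable section

-- single-problem summit: the doubled namespace component `ResolutionOfSingularities` is forced
set_option linter.dupNamespace false

open CategoryTheory AlgebraicGeometry TopologicalSpace IsLocalRing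
open Literature.AlgebraicGeometry.Resolution Literature.AlgebraicGeometry.Morphisms
open Literature.AlgebraicGeometry.Motives Literature.AlgebraicGeometry.Motives.RatFn

universe u

namespace Summit.ResolutionOfSingularities.ResolutionOfSingularities.Theorems.NoZeno.Lipman12B

/-- **Lipman 1969, Proposition (16.5) — THEOREM** (the named fact `Lipman1969_16_5`, every universe): one token over the
tree's reduction `Lipman1969_16_5_of_B` and `Lipman1969_1_2_B_holds`.
[cite: Lipman1969, Proposition (16.5) (p. 235, proof pp. 235–236)] -/
theorem Lipman1969_16_5_holds : Lipman1969_16_5.{u} :=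
  Lipman1969_16_5_of_B Lipman1969_1_2_B_holds.{u}

/-- **Lipman 1969, Proposition (16.5), rationality clause — unconditional**: under the hypotheses of (16.5) with `A`
normal, `A` has a rational singularity iff `B` does. [cite: Lipman1969, Proposition (16.5) (p. 235)] -/
theorem Lipman1969_16_5_rational_iff :
    ∀ (A B : Type u) [CommRing A] [CommRing B] [IsNoetherianRing A] [IsNoetherianRing B]
    [IsLocalRing A] [IsLocalRing B] [Algebra A B] [IsLocalHom (algebraMap A B)] [Module.Flat A B],
    IsReduced A →
    (maximalIdeal A).map (algebraMap A B) = maximalIdeal B →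
    Algebra.IsSeparable (ResidueField A) (ResidueField B) →
    ringKrullDim A = 2 → ringKrullDim B = 2 →
    (∃ (Y : Scheme.{u}) (g : Y ⟶ Spec (.of A)), IsResolution g) →
      (IsDomain A ∧ IsIntegrallyClosed A) →
        (HasRationalSingularity A ↔ HasRationalSingularity B) :=
  Lipman1969_16_5_rational_iff_of_B Lipman1969_1_2_B_holds.{u}

/-- **Lipman 1969, Prop. (13.1) d) for effective exceptional divisors over a rational surface singularity —
unconditional**: `(D·E_η) = h0 𝓘_η + h0 𝓛_t − h0(𝓛_t 𝓘_η)` for every effective exceptional divisor `D = V(𝓛_t)` on any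
desingularization of a two-dimensional normal local domain with a rational singularity.
[cite: Lipman1969, Proposition (13.1) d) (p. 223)] -/
theorem excCurveDegree_prod_eq_h0_of_hasRationalSingularity
    {S : Type u} [CommRing S] [IsNoetherianRing S] [IsLocalRing S] [IsDomain S] [IsIntegrallyClosed S]
    (hdim : ringKrullDim S = 2) (hrat : HasRationalSingularity S)
    {X : Scheme.{u}} [IsIntegral X] [IsLocallyNoetherian X] (π : X ⟶ Spec (.of S)) (hπ : IsResolution π)
    (t : Multiset X) (ht : ∀ ζ ∈ t, ζ ∈ excCurvePoints π) {η : X} (hη : η ∈ excCurvePoints π)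
    (hL : IsEffectiveCartier (t.map primeDivisorIdeal).prod) :
    excCurveDegree π (CartierDivisor.ofIsEffectiveCartier (t.map primeDivisorIdeal).prod hL) η =
      ((h0 π (primeDivisorIdeal η)).toNat : ℤ) + (h0 π (t.map primeDivisorIdeal).prod).toNat -
        (h0 π ((t.map primeDivisorIdeal).prod * primeDivisorIdeal η)).toNat :=
  excCurveDegree_prod_eq_h0 π hdim hπ (hasTrivialCechH1_of_isResolution_of_hasRationalSingularity hdim hrat π hπ)
    t ht hη hL

end Summit.ResolutionOfSingularities.ResolutionOfSingularities.Theorems.NoZeno.Lipman12B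

end
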